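import Literature.NumberTheory.EllipticCurves.DeShalitThetaTExpansionRational
import Literature.NumberTheory.EllipticCurves.FormalLogExpBaseChangeProofs
import Literature.NumberTheory.GaloisRepresentations.LubinTateInvariantDifferential
import HarnessLib

/-!
# The logarithmic Taylor coefficients of the theta `t`-expansion in the coordinate `z = log_W`:
# `k! · [z^k] dlog (Q_R^ψ ∘ exp_{W^ψ})` is FUNCTORIAL in `ψ` and at `ψ : R → ℂ` equals `−12 · E_{k+1}(Ω; L, 𝔞)`
# (de Shalit II §4.9 (i) + II §4.10 (26): the theta side of the MOMENT IDENTIFICATION, proofs only)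

Topic `NumberTheory/EllipticCurves` (theorems only; no definition, no named fact, no instance).  Sequel of
`DeShalitThetaTExpansionRational.lean` (★ `taylor_deShalitTheta_sub_eq_map_subst_formalExp`: the Taylor series `P` of
`Θ(Ω − z; L, L′, S)` is `φ(Q_R) ∘ exp_W`) and of `EisensteinNumbersThetaTaylorSeries.lean` (★★★
`PeriodPair.factorial_mul_coeff_dlog_taylor_deShalitTheta`: `k! · [z^k] (P′·P⁻¹) = −12·(#S·E_{k+1}(Ω, L) − E_{k+1}(Ω, L′))`),
written for the consumer `LubinTateColemanRelativeMomentLogCoordinateTwo.lean` (cell `bsd-print-cf2`, piece MI): there the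
relative Coates–Wiles value of a norm-coherent unit `β` with `g_β = (G ∘ [1]_{P′,f}) ∘ [a]_f` is
`k! · a^{k+1} · [z^k] dlog (G^j ∘ e_Λ)` with `Λ = log_{W}` read in an `F`-algebra `B`, i.e. `e_Λ = exp_{W^B}`; the present file
evaluates `k! · [z^k] dlog (G^ψ ∘ exp_{W^ψ})` when `G` is the algebraic theta `t`-expansion.

De Shalit II §4.10 (p. 64) (26): `δ_{k}(e(𝔞)) = Ω_p^k · (d/dz)^k log Θ(Ω − z; L, 𝔞)|_{z=0} = −12·Ω_p^k·E_k(Ω; L, 𝔞)`; the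
coefficients of `P` lie in the field `F = K(E[𝔣𝔞])` and are read `𝔓`-adically through `i_𝔓` (II §4.9 proof: «the Taylor
coefficients of `P` are in `F` … `Q ∈ F_𝔓⟦T⟧`»).  PROVED here (0 sorry):

* §1 (any commutative `ℚ`-algebras `S → S′`): `WeierstrassCurve.formalExp_eq_substInvOfIsUnit` (`exp_W` IS Mathlib's
  `substInvOfIsUnit log_W _` for ANY proof of the unit hypothesis — the `e_Λ` of the consumer), ★★ `dlog_units_subst_formalExp_map`
  — for units `Ge`, `Ge′` with underlying series `G ∘ exp_W` and `G^ψ ∘ exp_{W^ψ}`: **`dlog Ge′ = (dlog Ge)^ψ`**, hence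
  `coeff_dlog_units_subst_formalExp_map` **`[z^k] dlog (G^ψ ∘ exp_{W^ψ}) = ψ([z^k] dlog (G ∘ exp_W))`** — the logarithmic
  Taylor coefficients in the coordinate `z = log_W` are functorial in the coefficient ring (so the `𝔓`-adic and the complex
  readings of the theta expansion's coefficients are the images of ONE element of the number field carrying the data);
* §2 (de Shalit's complex reading): ★★★ `factorial_mul_coeff_dlog_units_map_thetaTExpansion_subst_formalExp` — in the setting of
  `taylor_deShalitTheta_sub_eq_map_subst_formalExp` (`φ : R → ℂ` carrying `x₀, y₀, x_c, K`; Néron lattice `L` of `W`; `Ω ∉ L′`),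
  for any unit `Pe` with underlying series `φ(Q_R) ∘ exp_W`:
  **`k! · [z^k] dlog Pe = −12 · (#S · E_{k+1}(Ω, L) − E_{k+1}(Ω, L′))`** (`= −12·E_{k+1}(Ω; L, 𝔞)`, II.4.10 (26) at `n = 0`
  without the period: the `Ω_p^k` is the consumer's `(coeff 1 ϑ)^k · a^{k+1}`).

## References
* [deShalit1987] E. de Shalit, *Iwasawa theory of elliptic curves with complex multiplication* (1987), II §3.1 (7), II §4.9
  Proposition (i) (p. 62–63), II §4.10 (26) (p. 64).
* [SilvermanAEC2009] J. H. Silverman, *The Arithmetic of Elliptic Curves*, 2nd ed. (2009), IV.5.5 (formal logarithm and exponential).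
-/

noncomputable section

open scoped Classical
open PowerSeries PeriodPair Literature.NumberTheory.EllipticCurves

namespace WeierstrassCurve

/-! ## §1 Functoriality of the logarithmic Taylor coefficients in the coordinate `z = log_W` -/

section Functorial

variable {S S' : Type*} [CommRing S] [CommRing S'] [Algebra ℚ S] [Algebra ℚ S'] (ψ : S →+* S') (W : WeierstrassCurve S)

/-- `exp_W` is Mathlib's compositional inverse `substInvOfIsUnit log_W h` for ANY proof `h` that `log_W′(0)` is a unit (the
consumer's `e_Λ = Λ.substInvOfIsUnit hΛ1` with `Λ = log_W`). [cite: SilvermanAEC2009, IV.5.5] -/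
theorem formalExp_eq_substInvOfIsUnit (h : IsUnit (coeff 1 W.formalLog)) : W.formalLog.substInvOfIsUnit h = W.formalExp := rfl

/-- ★★ **`dlog (G^ψ ∘ exp_{W^ψ}) = (dlog (G ∘ exp_W))^ψ`** for units `Ge`, `Ge′` with those underlying series: the logarithmic
derivative in the coordinate `z = log_W` commutes with a change of coefficient ring `ψ` (`exp_{W^ψ} = (exp_W)^ψ`).
[cite: SilvermanAEC2009, IV.5.5] [cite: deShalit1987, II §4.9 Proposition (i)] -/
theorem dlog_units_subst_formalExp_map (G : (S⟦X⟧)ˣ) (Ge : (S⟦X⟧)ˣ) (Ge' : (S'⟦X⟧)ˣ)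
    (hGe : (Ge : S⟦X⟧) = (G : S⟦X⟧).subst W.formalExp)
    (hGe' : (Ge' : S'⟦X⟧) = ((G : S⟦X⟧).map ψ).subst (W.map ψ).formalExp) :
    PowerSeries.dlog Ge' = (PowerSeries.dlog Ge).map ψ := by
  refine PowerSeries.dlog_eq_of_map_eq ψ Ge Ge' ?_
  have hms : PowerSeries.map ψ (PowerSeries.subst W.formalExp (G : S⟦X⟧)) =
      PowerSeries.subst (PowerSeries.map ψ W.formalExp) (PowerSeries.map ψ (G : S⟦X⟧)) :=
    PowerSeries.map_subst (HasSubst.of_constantCoeff_zero' W.constantCoeff_formalExp) _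
  rw [hGe', hGe, hms, W.map_formalExp ψ]

/-- ★★ **`[z^k] dlog (G^ψ ∘ exp_{W^ψ}) = ψ([z^k] dlog (G ∘ exp_W))`**: the logarithmic Taylor coefficients of a unit series in the
coordinate `z = log_W` are FUNCTORIAL in the coefficient ring — so for the theta `t`-expansion `Q_{K′}` over a number field `K′`
its `𝔓`-adic reading (`ψ = i_𝔓`, the consumer MI) and its complex reading (`ψ = ι̂`, §2) are images of the same element of `K′`.
[cite: deShalit1987, II §4.9 Proposition (i), II §4.10 (26)] -/
theorem coeff_dlog_units_subst_formalExp_map (G : (S⟦X⟧)ˣ) (Ge : (S⟦X⟧)ˣ) (Ge' : (S'⟦X⟧)ˣ)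
    (hGe : (Ge : S⟦X⟧) = (G : S⟦X⟧).subst W.formalExp)
    (hGe' : (Ge' : S'⟦X⟧) = ((G : S⟦X⟧).map ψ).subst (W.map ψ).formalExp) (k : ℕ) :
    coeff k (PowerSeries.dlog Ge') = ψ (coeff k (PowerSeries.dlog Ge)) := by
  rw [dlog_units_subst_formalExp_map ψ W G Ge Ge' hGe hGe', coeff_map]

/-- … with the `k!`: `k! · [z^k] dlog (G^ψ ∘ exp_{W^ψ}) = ψ(k! · [z^k] dlog (G ∘ exp_W))`. [cite: deShalit1987, II §4.10 (26)] -/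
theorem factorial_mul_coeff_dlog_units_subst_formalExp_map (G : (S⟦X⟧)ˣ) (Ge : (S⟦X⟧)ˣ) (Ge' : (S'⟦X⟧)ˣ)
    (hGe : (Ge : S⟦X⟧) = (G : S⟦X⟧).subst W.formalExp)
    (hGe' : (Ge' : S'⟦X⟧) = ((G : S⟦X⟧).map ψ).subst (W.map ψ).formalExp) (k : ℕ) :
    (k.factorial : S') * coeff k (PowerSeries.dlog Ge') = ψ ((k.factorial : S) * coeff k (PowerSeries.dlog Ge)) := by
  rw [coeff_dlog_units_subst_formalExp_map ψ W G Ge Ge' hGe hGe', map_mul, map_natCast]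

end Functorial

/-! ## §2 The complex reading: `k! · [z^k] dlog (φ(Q_R) ∘ exp_W) = −12 · E_{k+1}(Ω; L, 𝔞)` -/

section Complex

variable {R : Type*} [CommRing R] (WR : WeierstrassCurve R) (x₀ y₀ : R) (x : ℂ → R) (u : ℂ → Rˣ) (K : R) (φ : R →+* ℂ)
  (W : WeierstrassCurve ℂ) (L : PeriodPair) {L' : PeriodPair} {S : Finset ℂ} {Ω : ℂ}

/-- For a unit `u` of `ℂ⟦X⟧` the `Units` inverse is the field-power-series inverse. [folklore] -/
private theorem units_coe_inv_eq_inv (Pe : (ℂ⟦X⟧)ˣ) : ((Pe⁻¹ : (ℂ⟦X⟧)ˣ) : ℂ⟦X⟧) = (Pe : ℂ⟦X⟧)⁻¹ := by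
  have h0 : constantCoeff (Pe : ℂ⟦X⟧) ≠ 0 := by
    intro h
    have hu := PowerSeries.isUnit_iff_constantCoeff.mp Pe.isUnit
    rw [h] at hu
    exact not_isUnit_zero hu
  exact (PowerSeries.eq_inv_iff_mul_eq_one h0).mpr (by rw [← Units.val_mul, inv_mul_cancel, Units.val_one])

/-- ★★★ **De Shalit II §4.10 (26) at `n = 0`, the theta side of the moment identification**: in the setting of
`taylor_deShalitTheta_sub_eq_map_subst_formalExp` (`φ : R → ℂ` carrying `x₀ = x(ξΩ)`, `y₀`, `x_c = x(E[𝔞] ∖ O)`, `K`; `W = W_R ⊗ ℂ`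
with Néron lattice `L`; `S` representatives of `𝔞⁻¹L/L`, `L′` of lattice `𝔞⁻¹L`; `Ω ∉ L′`), for ANY unit `Pe` of `ℂ⟦z⟧` whose underlying
series is `φ(Q_R) ∘ exp_W` (so `Pe = P`, the Taylor series of `Θ(Ω − z; L, L′, S)`):
`k! · [z^k] dlog Pe = −12 · (#S · E_{k+1}(Ω, L) − E_{k+1}(Ω, L′))` (`= −12·E_{k+1}(Ω; L, 𝔞)`, II §3.1 (7) at `z = Ω`).
[cite: deShalit1987, II §4.9 Proposition (i), II §4.10 (26) (p. 64), II §3.1 (7)] -/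
theorem factorial_mul_coeff_dlog_units_map_thetaTExpansion_subst_formalExp (hS : L.IsLatticeReps L' S)
    (h₂ : L.g₂ = W.c₄ / 12) (h₃ : L.g₃ = W.c₆ / 216) (hΩ : Ω ∉ L'.lattice) (hV : WR.map φ = W)
    (ha : φ x₀ = ℘[L] Ω - W.b₂ / 12) (hb : φ y₀ = (℘'[L] Ω - W.a₁ * (℘[L] Ω - W.b₂ / 12) - W.a₃) / 2)
    (hK : φ K = L.deltaRatio L' * (L.g₂ ^ 3 - 27 * L.g₃ ^ 2) ^ (S.card - 1))
    (hx : ∀ c ∈ S.erase 0, φ (x c) = ℘[L] c - W.b₂ / 12) (hu : ∀ c ∈ S.erase 0, (u c : R) = x₀ - x c)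
    (Pe : (ℂ⟦X⟧)ˣ)
    (hPe : (Pe : ℂ⟦X⟧) = (PowerSeries.map φ (C K * ∏ c ∈ S.erase 0,
        PowerSeries.invOfUnit ((WR.translateX x₀ y₀).subst WR.formalNeg - C (x c)) (u c) ^ 6)).subst W.formalExp)
    (k : ℕ) :
    (k.factorial : ℂ) * coeff k (PowerSeries.dlog Pe) =
      -12 * ((S.card : ℂ) * L.eisensteinE (k + 1) Ω - L'.eisensteinE (k + 1) Ω) := by
  have hP : (Pe : ℂ⟦X⟧) =
      PowerSeries.mk fun n => ((Nat.factorial n : ℂ))⁻¹ * iteratedDeriv n (fun v => L.deShalitTheta L' S (Ω - v)) 0 := by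
    rw [hPe, WR.taylor_deShalitTheta_sub_eq_map_subst_formalExp x₀ y₀ x u K φ W L hS h₂ h₃ hΩ hV ha hb hK hx hu]
  rw [PowerSeries.dlog_def, units_coe_inv_eq_inv, hP]
  exact L.factorial_mul_coeff_dlog_taylor_deShalitTheta hS k hΩ

end Complex

end WeierstrassCurve

end
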